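import Mathlib
import HarnessLib
import HarnessLib.Audit
import Summits.Langlands.Langlands.Theorems.ReductionSignatureSplit

/-!
# NearlyOrdinaryDistinguishedSplit — lens-5 g34 node on RES33 = `ReductionSignatureSplit.SignatureResidual` (door 4c), and on CORE through g33's kernel

TARGET (tree decl, BY NAME): RES33 = `Summit.Langlands.Langlands.Theorems.ReductionSignatureSplit.SignatureResidual` (g33,
`Theorems/ReductionSignatureSplitPrelude.lean`, p833584): every integral `E` (`Δ ≠ 0`) over an UNANCHORED totally real field
`K₀` of degree `≥ 6` (`UnanchoredBox K₀`), of residual moduli degree (`InResidualRange K₀ E`), off the Allen locus, OFF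
g30's three doors (`OffDoors K₀ E`: not generic at `3, 5, 7`, on no Skinner–Wiles locus, on no Pan–Zhang locus) and OFF
g33's three signature doors (`OffSignatureDoors K₀ E`: not on 4a `NOLocus K₀ E 3`, not on 4b `SplitNOLocus`, not on 5
`MixLocus`) is modular; one level up CORE = `OddPrimeDoorSplit.CoreResidual` (g30) through g33's `core_of_pieces`.
Lineage: REST (stmt-Langlands-26998) → REST_E (g26) → LJR (g27) → RES (g28) → CORE (g30) → RES33 (g33); sibling cuts of
CORE in the tree: g31 `RealCyclotomicDoorSplit` (field cells), g32 `ModuliFieldDescentSplit` (moduli-field descent), g33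
`ReductionSignatureSplit` (signature doors 4a/4b/5).

THESIS OF THE CUT (lens 5 «finite/base range + asymptotic regime + bridge», the bridge widened to its printed
hypotheses).  g30's door 2 (`SWLocus`: potentially MULTIPLICATIVE above `p` and `μ_p ⊄ K₀ᵥ`) and g33's doors 4a/4b
(`NoLocalMuAbove` at `p = 3`, resp. `p` totally split) are three CONVENIENT sub-loci of the hypotheses of ONE
printed theorem — Skinner–Wiles 2001, Thm. 5.1 [SkinnerWiles2001, Thm. 5.1, p. 204 = PDF p. 20]: `F` ANY totally real field,
`p` an odd prime, `ρ : G_F → GL₂` continuous, irreducible, finitely ramified, `det ρ = ψε^{k-1}` odd, NEARLY ORDINARY at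
every place above `p` ((5.1), p. 203), with (i) `ρ̄^ss` irreducible and `D_i`-DISTINGUISHED for all `i = 1, …, t`
(the places of `F` above `p`; "`D_i`-distinguished" = the two diagonal characters of `ρ̄^ss|_{D_i}` are distinct,
p. 20) and (ii) a nearly ordinary automorphic `π₀` with `ρ_{π₀}` a `χ₂`-good lift of `ρ̄^ss` ⇒ `ρ ≃ ρ_π`.
Door 4c types (5.1) + (i) for `ρ = ρ_{E,p}` DIRECTLY and GALOIS-LOCALLY on the torsion module `E[p]`:
* `NoSupersingularAbove K₀ E p` (g33's tree dial, BY NAME): no place `v ∣ p` has `v(j_E − j_ss(p)) > 0`, i.e. `E` is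
  potentially ordinary or potentially multiplicative at every `v ∣ p` ⟺ `ρ_{E,p}|_{D_v}` nearly ordinary for all
  `v ∣ p` ((5.1)(v)); (5.1)(i)–(iv) are automatic for `ρ_{E,p}` over a totally real field (`det = ε`, odd).
* `DistinguishedAbove K₀ E p` (NEW DIAL): for every framing `ρ̄` of `E[p] ⊗ K₀` and every `v ∣ p` some
  `σ ∈ Γ_{K₀ᵥ}` has `tr(ρ̄|ᵥ σ)² − 4·det(ρ̄|ᵥ σ) ≠ 0` (restriction `FramedGaloisRep.toLocal v`), i.e. `ρ̄(σ)` has two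
  DISTINCT eigenvalues (`p` odd): exactly "`ρ̄^ss|_{D_v}` is not isotypic" = `D_v`-distinguished (a 2-dimensional
  semisimple representation `χ₁ ⊕ χ₂` of a group has `χ₁ = χ₂` iff every element acts with a double eigenvalue).
* `ModPAbsIrreducible K₀ E p ∧ ¬ ModPImageAbsIrreducibleOverCyclotomic` (g30 dials): `ρ̄` absolutely irreducible but
  NOT generic at `p`, hence (Clifford along the cyclic `K₀(ζ_p)/K₀`) induced from a character of the quadratic
  subfield `M ⊂ K₀(ζ_p)`: the DIHEDRAL case "that eludes [W], [Dl], [F]" for which (ii) is supplied in print by the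
  weight-one theta series of the Teichmüller lift of the inducing character, `p`-stabilised and moved to parallel
  weight `2` in its nearly ordinary Hida family [Wiles1988; Hida1989] — the SAME input the critic accepted as PRINT for
  g30's SWD and g33's 4a/4b.
`NODLocus K₀ E p` is the conjunction; `OnNODDoor K₀ E` := `NODLocus` at some `p ∈ {3, 5, 7}`; the junction
`NearlyOrdinaryDistinguishedDoor` (NODD, binder, credits nothing) says: on the locus, `E` is modular.
ON PAPER NODD ⊇ SWD ∪ NOD₃ ∪ NOS: `SWLocus ⊆ NODLocus` (Tate curve: `ρ_{E,p}|_{D_v} ≃ (τε *; 0 τ)`, so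
`ρ̄^ss|_{D_v} = τ̄ε̄ ⊕ τ̄` is distinguished iff `ε̄|_{D_v} ≠ 1` iff `μ_p ⊄ K₀ᵥ` = `NoLocalMuAbove`), `NOLocus₃ ⊆ NODLocus₃`
and `SplitNOLocus ⊆ NODLocus` (g33 module docstring (2)) — the full inclusions need the local Galois structure of Tate
curves / ordinary curves, ABSENT from the tree, and are DECLARED, NOT derived; what IS derived is each inclusion MODULO
the new dial (`nodLocus_of_swLocus`, `nodLocus_of_noLocus`, `nodLocus_of_splitNOLocus`: locus ∧ `DistinguishedAbove` ⇒
`NODLocus`), i.e. 4c = (4a ∪ 4b ∪ 2 widened to every nearly-ordinary signature and every field) ∩ distinguished.  The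
kernel does not use the inclusions: `OffDoors` / `OffSignatureDoors` already remove doors 2, 4a, 4b.  What 4c ADDS over 2 ∪ 4a ∪ 4b: potentially (good) ORDINARY places `v ∣ p` with
`K₀ᵥ ≠ ℚ_p` and `μ_p ⊂ K₀ᵥ` allowed as long as `ρ̄^ss|_{D_v}` is non-isotypic (e.g. `p = 5, 7` n.o. places where the
nebentype character `χ̄₂² ≠ 1` on `D_v`), and mixed ordinary/multiplicative signatures at `p = 5, 7` over
non-split `p`.
RESIDUAL (declared, IDEA-NEEDED): `Residual34` = RES33 restricted to `¬ OnNODDoor K₀ E`: for EACH `p ∈ {3,5,7}` either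
`ρ̄_{E,p}` is not absolutely irreducible (the Borel / Cartan-normaliser corner of g31 — UNTOUCHED by 4c:
`offNODDoor_of_borel`), or some `v ∣ p` is a potentially supersingular place with `p` not totally split (no printed
lifting theorem: Pan 2022 / X. Zhang 2024 need `K₀ᵥ = ℚ_p`; Thorne 2026 arXiv:2603.09765 gives POTENTIAL
modularity only), or `ρ̄_{E,p}^ss|_{D_v}` is isotypic at some nearly ordinary `v ∣ p` (Skinner–Wiles 2001 excluded;
Allen 2014 arXiv:1301.1113 needs `p` totally split… and `p ≥ 5`; no E-level print statement over a general `K₀`).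

KERNEL THEOREMS (no `sorry`): `nodSector_closed : NODD → NODSector`; RES33 ⟸ NODSector ∧ Residual34
(`signatureResidual_of_pieces`, excluded middle on door 4c) and RES33 ⟹ each piece; `signatureResidual_iff_pieces`;
CORE ⟸ NOD₃ ∧ NOS ∧ MIX ∧ NODD ∧ Residual34 (`core_of_pieces34`, through g33's `core_of_pieces`) and `core_iff_residual34`;
the joint lemmas with g30/g33 (`nodLocus_of_swLocus` / `_of_noLocus` / `_of_splitNOLocus`) and with g31
(`offNODDoor_of_borel`: a Borel framing at `p` is off the locus at `p`, via g33's `not_modPAbsIrreducible_of_borelAt`;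
`not_distinguishedPlace_of_scalar`: sanity of the new dial); compositions BY NAME up to RES (`residual_of_pieces34`),
LJR, REST_E and REST = stmt-Langlands-26998 (`closes_target`, `closes_byName`, through g33's
`ReductionSignatureSplit.closes_target`); necessity `pieces_of_restE`.  No `instance`, no `notation`; every dial is a
property of `j(E)`, of the Galois module `E[p]` or of `K₀` (model-invariant).

References: [SkinnerWiles2001] C. Skinner, A. Wiles, *Nearly ordinary deformations of irreducible residual
representations*, Ann. Fac. Sci. Toulouse Math. (6) 10 (2001) 185–215, doi:10.5802/afst.988 — (5.1) p. 203, Thm. 5.1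
p. 204, Thm. 5.2 p. 205, main theorem p. 186 [corpus: paper:doi-10-5802-afst-988, PDF pp. 3, 20, 21];
[Wiles1988] Invent. Math. 94, 529–573 (Λ-adic forms, theta series in Hida families); [Hida1989] nearly ordinary Hecke
algebras over totally real fields; [Allen2014] arXiv:1301.1113 (p. 3: SW removed the Taylor–Wiles hypothesis in the
ordinary distinguished case); [FreitasLeHungSiksek2015] arXiv:1310.7088 Thms. 3–4; [XZhang2024] arXiv:2412.06812
Thm. 6.1.1, Rem. 6.1.2; [Pan2022] arXiv:1901.07166; [Thorne2026] arXiv:2603.09765 (potential modularity only).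
-/

set_option linter.dupNamespace false
set_option linter.unusedVariables false

open scoped NumberField IntermediateField MatrixGroups
open NumberField IsDedekindDomain Field Literature.NumberTheory.Automorphic
open Literature.NumberTheory.GaloisRepresentations
open Summit.Langlands.Langlands.Theorems.DepthIsolationSplit (UnanchoredBox UnanchoredHighDegreeModularE
  IntegralModelTransferPointwise SatakeAvatarTwo satakeAvatarTwo_of_host)
open Summit.Langlands.Langlands.Theorems.JDegreeFilterSplit (jInv jDeg InResidualRange LargeJResidual
  RatBaseChangeModularity SmallFieldBaseChange)
open Summit.Langlands.Langlands.Theorems.DyadicDoorSplit (AllenLocus AllenDyadicCorollary DyadicDegenerateResidual)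
open Summit.Langlands.Langlands.Theorems.OddPrimeDoorSplit (Generic357 ModPAbsIrreducible PotMultAbove NoLocalMuAbove
  SWLocus OnSWDoor TotallySplitAt PotSupersingularAbove PZLocus OnPZDoor OffDoors SkinnerWilesDihedralDoor
  PanZhangSupersingularDoor CoreResidual core_of_restE)
open Summit.Langlands.Langlands.Theorems.RealCyclotomicDoorSplit (BorelAt)
open Summit.Langlands.Langlands.Theorems.ReductionSignatureSplit (SupersingularPlace NoSupersingularAbove
  noSupersingularAbove_of_potMultAbove NOLocus OnNODoor SplitNOLocus OnSplitNODoor MixLocus OnMixDoor OffSignatureDoors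
  noLocus_of_swLocus NearlyOrdinaryDihedralDoorThree SplitOrdinaryDihedralDoor MixedSignatureDoor SignatureResidual
  signatureResidual_of_core not_modPAbsIrreducible_of_borelAt)

namespace Summit.Langlands.Langlands.Theorems.NearlyOrdinaryDistinguishedSplit

/-! ## §1 The dials at an odd prime `p` (properties of the Galois module `E[p]` only; the signature dial `NoSupersingularAbove` is g33's, by name) -/

/-- `ρ̄ : Γ_{K₀} → GL₂(𝔽_p)` is DISTINGUISHED AT the finite place `v` (intended `v ∣ p`, `p` odd): some element of the
decomposition group `Γ_{K₀ᵥ}` (`K₀ᵥ = v.adicCompletion K₀`, restriction `FramedGaloisRep.toLocal v`) acts with two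
DISTINCT eigenvalues, `tr² − 4·det ≠ 0` — equivalently (for `p ≠ 2`) the semisimplification `ρ̄^ss|_{Γ_{K₀ᵥ}} = χ₁ ⊕ χ₂`
has `χ₁ ≠ χ₂`: Skinner–Wiles' "`D_v`-distinguished" [SkinnerWiles2001, p. 204].  Conjugation-invariant. -/
def DistinguishedPlace (K₀ : Type) [Field K₀] [NumberField K₀] (p : ℕ) (ρ : FramedGaloisRep K₀ (ZMod p) 2)
    (v : HeightOneSpectrum (𝓞 K₀)) : Prop :=
  ∃ σ : absoluteGaloisGroup (v.adicCompletion K₀),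
    ((FramedGaloisRep.toLocal v ρ σ : GL (Fin 2) (ZMod p)) : Matrix (Fin 2) (Fin 2) (ZMod p)).trace ^ 2 -
        4 * ((FramedGaloisRep.toLocal v ρ σ : GL (Fin 2) (ZMod p)) : Matrix (Fin 2) (Fin 2) (ZMod p)).det ≠ 0

/-- `ρ̄_{E,p}` is `D_v`-DISTINGUISHED AT EVERY `v ∣ p` (Skinner–Wiles Thm. 5.1 (i), second half), for every framing of
the Galois action on `(E ⊗ K₀)[p]` (all framings are conjugate; the clause is conjugation-invariant). -/
def DistinguishedAbove (K₀ : Type) [Field K₀] [NumberField K₀] (E : WeierstrassCurve (𝓞 K₀)) (p : ℕ)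
    [Fact p.Prime] : Prop :=
  ∀ ρ : ModPGaloisRep K₀ (ZMod p) 2, (E.baseChange K₀).IsTorsionGaloisRep p ρ →
    ∀ v : HeightOneSpectrum (𝓞 K₀), (p : 𝓞 K₀) ∈ v.asIdeal → DistinguishedPlace K₀ p ρ v

/-- THE NEARLY-ORDINARY DISTINGUISHED LOCUS at `p` = Skinner–Wiles 2001 (5.1) + Thm. 5.1 (i) for `ρ_{E,p}`, in the
dihedral (non-generic) case: `ρ̄_{E,p}` absolutely irreducible, NOT generic at `p`, nearly ordinary above `p`, and
`D_v`-distinguished at every `v ∣ p`.  On paper CONTAINS g30's `SWLocus K₀ E p` and g33's `NOLocus`/`SplitNOLocus`. -/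
def NODLocus (K₀ : Type) [Field K₀] [NumberField K₀] (E : WeierstrassCurve (𝓞 K₀)) (p : ℕ) [Fact p.Prime] : Prop :=
  ModPAbsIrreducible K₀ E p ∧ ¬ ModPImageAbsIrreducibleOverCyclotomic (E.baseChange K₀) p ∧
    NoSupersingularAbove K₀ E p ∧ DistinguishedAbove K₀ E p

/-- DOOR 4c: `E` lies on the nearly-ordinary distinguished locus at some `p ∈ {3, 5, 7}`. -/
def OnNODDoor (K₀ : Type) [Field K₀] [NumberField K₀] (E : WeierstrassCurve (𝓞 K₀)) : Prop :=
  ∃ (p : ℕ) (hp : p.Prime), (p = 3 ∨ p = 5 ∨ p = 7) ∧ @NODLocus K₀ _ _ E p ⟨hp⟩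

/-! ## §1b Joint lemmas with g30 (door 2), g33 (doors 4a/4b) and g31 (Borel framings); sanity of the new dial -/

/-- 4c minus the new dial is the common core of g33's doors 4a/4b: absolutely irreducible, non-generic, nearly ordinary. -/
theorem noData_of_nodLocus {K₀ : Type} [Field K₀] [NumberField K₀] {E : WeierstrassCurve (𝓞 K₀)} {p : ℕ} [Fact p.Prime]
    (h : NODLocus K₀ E p) :
    ModPAbsIrreducible K₀ E p ∧ ¬ ModPImageAbsIrreducibleOverCyclotomic (E.baseChange K₀) p ∧ NoSupersingularAbove K₀ E p :=
  ⟨h.1, h.2.1, h.2.2.1⟩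

/-- Door 4a ⊆ door 4c MODULO the new dial: g33's `NOLocus` (at any `p`) ∧ `DistinguishedAbove` ⇒ `NODLocus`.  (On paper
the dial is automatic on `NOLocus K₀ E 3` — g33's docstring: `χ̄₂² = 1` at nearly ordinary `3`-adic places, so distinguished
⟺ `μ₃ ⊄ K₀ᵥ` = `NoLocalMuAbove K₀ 3`; that step needs Tate-curve / ordinary local structure absent from the tree.) -/
theorem nodLocus_of_noLocus {K₀ : Type} [Field K₀] [NumberField K₀] {E : WeierstrassCurve (𝓞 K₀)} {p : ℕ} [Fact p.Prime]
    (h : NOLocus K₀ E p) (hd : DistinguishedAbove K₀ E p) : NODLocus K₀ E p :=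
  ⟨h.1, h.2.1, h.2.2.1, hd⟩

/-- Door 4b ⊆ door 4c MODULO the new dial: g33's `SplitNOLocus` ∧ `DistinguishedAbove` ⇒ `NODLocus` (on paper automatic:
`K₀ᵥ = ℚ_p`, g33's docstring (2)). -/
theorem nodLocus_of_splitNOLocus {K₀ : Type} [Field K₀] [NumberField K₀] {E : WeierstrassCurve (𝓞 K₀)} {p : ℕ}
    [Fact p.Prime] (h : SplitNOLocus K₀ E p) (hd : DistinguishedAbove K₀ E p) : NODLocus K₀ E p :=
  ⟨h.2.1, h.2.2.1, h.2.2.2, hd⟩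

/-- Door 2 ⊆ door 4c MODULO the new dial: g30's `SWLocus` ∧ `DistinguishedAbove` ⇒ `NODLocus` (through g33's
`noLocus_of_swLocus`: potentially multiplicative ⇒ nearly ordinary; on paper the dial is automatic on `SWLocus`: Tate curve,
`ε̄|_{D_v} ≠ 1` ⟺ `μ_p ⊄ K₀ᵥ`). -/
theorem nodLocus_of_swLocus {K₀ : Type} [Field K₀] [NumberField K₀] {E : WeierstrassCurve (𝓞 K₀)} {p : ℕ} [Fact p.Prime]
    (h : SWLocus K₀ E p) (hd : DistinguishedAbove K₀ E p) : NODLocus K₀ E p :=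
  nodLocus_of_noLocus (noLocus_of_swLocus h) hd

/-- Pure supersingular signature above `p` (door 3's local clause) excludes 4c's as soon as SOME place lies above `p`. -/
theorem not_nodLocus_of_potSupersingular {K₀ : Type} [Field K₀] [NumberField K₀] {E : WeierstrassCurve (𝓞 K₀)}
    {p : ℕ} [Fact p.Prime] (h : PotSupersingularAbove K₀ E p) (hv : ∃ v : HeightOneSpectrum (𝓞 K₀), (p : 𝓞 K₀) ∈ v.asIdeal) :
    ¬ NODLocus K₀ E p := by
  obtain ⟨v, hv⟩ := hv
  exact fun hn => hn.2.2.1 v hv (h v hv)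

/-- SANITY of the new dial: a framing whose decomposition-group image at `v` is SCALAR is not distinguished at `v`
(`tr(aI)² − 4 det(aI) = 4a² − 4a² = 0`). -/
theorem not_distinguishedPlace_of_scalar {K₀ : Type} [Field K₀] [NumberField K₀] {p : ℕ}
    (ρ : FramedGaloisRep K₀ (ZMod p) 2) (v : HeightOneSpectrum (𝓞 K₀))
    (h : ∀ σ : absoluteGaloisGroup (v.adicCompletion K₀), ∃ a : ZMod p,
      ((FramedGaloisRep.toLocal v ρ σ : GL (Fin 2) (ZMod p)) : Matrix (Fin 2) (Fin 2) (ZMod p)) =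
        a • (1 : Matrix (Fin 2) (Fin 2) (ZMod p))) :
    ¬ DistinguishedPlace K₀ p ρ v := by
  rintro ⟨σ, hσ⟩
  obtain ⟨a, ha⟩ := h σ
  apply hσ
  rw [ha]
  simp [Matrix.trace]
  ring

/-- Borel at `p` (g31's `BorelAt`) ⇒ off the nearly-ordinary distinguished locus at `p` (through g33's
`not_modPAbsIrreducible_of_borelAt`). -/
theorem not_nodLocus_of_borelAt {K₀ : Type} [Field K₀] [NumberField K₀] {E : WeierstrassCurve (𝓞 K₀)}
    {p : ℕ} [Fact p.Prime] (h : BorelAt K₀ E p) : ¬ NODLocus K₀ E p :=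
  fun hn => not_modPAbsIrreducible_of_borelAt h hn.1

/-- JOINT WITH g31: a curve Borel at `3`, `5` and `7` (g31's cell `B3B5B7`, the reducible corner) is OFF door 4c —
door 4c does not touch the reducible corner (honest scope statement, kernel-checked). -/
theorem offNODDoor_of_borel {K₀ : Type} [Field K₀] [NumberField K₀] {E : WeierstrassCurve (𝓞 K₀)}
    (h3 : BorelAt K₀ E 3) (h5 : BorelAt K₀ E 5) (h7 : BorelAt K₀ E 7) : ¬ OnNODDoor K₀ E := by
  rintro ⟨p, hp, hp357, hloc⟩
  haveI : Fact p.Prime := ⟨hp⟩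
  rcases hp357 with rfl | rfl | rfl
  · exact not_nodLocus_of_borelAt h3 hloc
  · exact not_nodLocus_of_borelAt h5 hloc
  · exact not_nodLocus_of_borelAt h7 hloc

/-- Door 4c never meets door 1 at the same prime (it asks for NON-genericity at `p`). -/
theorem not_generic_at_of_nodLocus {K₀ : Type} [Field K₀] [NumberField K₀] {E : WeierstrassCurve (𝓞 K₀)}
    {p : ℕ} [Fact p.Prime] (h : NODLocus K₀ E p) : ¬ ModPImageAbsIrreducibleOverCyclotomic (E.baseChange K₀) p :=
  h.2.1

/-! ## §2 The print junction (door 4c): Skinner–Wiles 2001, Thm. 5.1 at the torsion primes 3, 5, 7 (E-level) -/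

/-- NODD — NEARLY-ORDINARY DISTINGUISHED DOOR (PRINT junction, E-level, for EVERY totally real field; binder, credits
nothing; on paper CONTAINS g30's `SkinnerWilesDihedralDoor` and g33's doors 4a/4b): an integral `E` (`Δ ≠ 0`) over a
totally real `K` on `NODLocus K E p` for some `p ∈ {3, 5, 7}` is modular.  Print chain: (1) `ρ := ρ_{E,p}` satisfies
Skinner–Wiles (5.1) [SkinnerWiles2001, (5.1), p. 203]: continuous, irreducible (`ρ̄` absolutely irreducible),
finitely ramified, `det ρ = ε` odd (`K` totally real), nearly ordinary at every `v ∣ p` (`NoSupersingularAbove`: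
potentially ordinary or multiplicative reduction, `ρ|_{D_v} ≃ (χ₁ *; 0 χ₂)`); (2) (i): `ρ̄` irreducible and
`D_v`-distinguished for all `v ∣ p` (`DistinguishedAbove`, read on `ρ̄^ss|_{D_v}` via `tr² − 4 det`); (3) (ii): `ρ̄`
absolutely irreducible and NOT generic at `p`, so by Clifford theory along the cyclic `K(ζ_p)/K` it is induced from a
character `χ̄` of the quadratic subfield `M ⊂ K(ζ_p)`; the weight-one theta series of the Teichmüller lift of `χ̄`
(Hecke; automorphic induction), twisted by a global finite-order character to be `U_v`-ordinary at each `v ∣ p` and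
moved to parallel weight `2` in its nearly ordinary Hida family, gives a nearly ordinary `π₀` with `ρ_{π₀}` a `χ₂`-good
lift of `ρ̄^ss = ρ̄` [Wiles1988; Hida1989] — the SAME printed input as in g30's door-2 chain (3); (4) Thm. 5.1
[SkinnerWiles2001, Thm. 5.1, p. 204]: `ρ ≃ ρ_π` for a nearly ordinary Hilbert cusp form `π` of parallel weight `2`, so
`E` is modular (Thm. 5.2, p. 205, for the passage to `IsModularEllipticCurve`).  NOT in the tree (no Skinner–Wiles 2001
fact is vendored).  [ref: SkinnerWiles2001, Thm. 5.1] [ref: Wiles1988] [ref: Allen2014, p. 3] [ref: XZhang2024,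
Rem. 6.1.2 ("In the ordinary case, the result is known by [SW01], [Kisin09], [HuTan15]")] -/
def NearlyOrdinaryDistinguishedDoor : Prop :=
  ∀ (K : Type) [Field K] [NumberField K] [IsTotallyReal K] (E : WeierstrassCurve (𝓞 K)), E.Δ ≠ 0 →
    ∀ (p : ℕ) [Fact p.Prime], (p = 3 ∨ p = 5 ∨ p = 7) → NODLocus K E p → IsModularEllipticCurve K E

/-! ## §3 The pieces of RES33 along door 4c -/

/-- NODSector — RES33 restricted to door 4c (CLOSED from the junction NODD: `nodSector_closed`). -/
def NODSector : Prop :=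
  ∀ (K₀ : Type) [Field K₀] [NumberField K₀], UnanchoredBox K₀ →
    ∀ E : WeierstrassCurve (𝓞 K₀), E.Δ ≠ 0 → InResidualRange K₀ E → ¬ AllenLocus K₀ E → OffDoors K₀ E →
      OffSignatureDoors K₀ E → OnNODDoor K₀ E → IsModularEllipticCurve K₀ E

/-- Residual34 — RES33 OFF door 4c (declared residual, IDEA-NEEDED): for each `p ∈ {3, 5, 7}`, `ρ̄_{E,p}` is not
absolutely irreducible, or generic (impossible under `OffDoors`), or some `v ∣ p` is a potentially supersingular place
(with `p` NOT totally split, by `OffDoors`/`OffSignatureDoors`), or `ρ̄_{E,p}^ss|_{D_v}` is isotypic at some `v ∣ p`. -/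
def Residual34 : Prop :=
  ∀ (K₀ : Type) [Field K₀] [NumberField K₀], UnanchoredBox K₀ →
    ∀ E : WeierstrassCurve (𝓞 K₀), E.Δ ≠ 0 → InResidualRange K₀ E → ¬ AllenLocus K₀ E → OffDoors K₀ E →
      OffSignatureDoors K₀ E → ¬ OnNODDoor K₀ E → IsModularEllipticCurve K₀ E

/-! ## §4 Kernel theorems -/

/-- NODSector is CLOSED from the junction NODD (an unanchored box field is totally real). -/
theorem nodSector_closed (hNOD : NearlyOrdinaryDistinguishedDoor) : NODSector := by
  intro K₀ _ _ hb E hΔ _ _ _ _ hn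
  haveI : IsTotallyReal K₀ := hb.1
  obtain ⟨p, hp, h357, hloc⟩ := hn
  haveI : Fact p.Prime := ⟨hp⟩
  exact hNOD K₀ E hΔ p h357 hloc

/-- THE SPLIT: RES33 ⟸ NODSector ∧ Residual34 (excluded middle on door 4c). -/
theorem signatureResidual_of_pieces (hS : NODSector) (hR : Residual34) : SignatureResidual := by
  intro K₀ _ _ hb E hΔ hr hA hoff h33
  by_cases hn : OnNODDoor K₀ E
  · exact hS K₀ hb E hΔ hr hA hoff h33 hn
  · exact hR K₀ hb E hΔ hr hA hoff h33 hn

/-- RES33 ⟸ NODD ∧ Residual34. -/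
theorem signatureResidual_of_door (hNOD : NearlyOrdinaryDistinguishedDoor) (hR : Residual34) : SignatureResidual :=
  signatureResidual_of_pieces (nodSector_closed hNOD) hR

/-- NECESSITY: RES33 ⟹ NODSector. -/
theorem nodSector_of_signatureResidual (h : SignatureResidual) : NODSector :=
  fun K₀ _ _ hb E hΔ hr hA hoff h33 _ => h K₀ hb E hΔ hr hA hoff h33

/-- NECESSITY: RES33 ⟹ Residual34 (a sub-locus). -/
theorem residual34_of_signatureResidual (h : SignatureResidual) : Residual34 :=
  fun K₀ _ _ hb E hΔ hr hA hoff h33 _ => h K₀ hb E hΔ hr hA hoff h33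

/-- EXACTNESS: RES33 ⟺ NODSector ∧ Residual34. -/
theorem signatureResidual_iff_pieces : SignatureResidual ↔ NODSector ∧ Residual34 :=
  ⟨fun h => ⟨nodSector_of_signatureResidual h, residual34_of_signatureResidual h⟩,
    fun h => signatureResidual_of_pieces h.1 h.2⟩

/-- EXACTNESS modulo the junction: NODD → (RES33 ⟺ Residual34). -/
theorem signatureResidual_iff_residual34 (hNOD : NearlyOrdinaryDistinguishedDoor) : SignatureResidual ↔ Residual34 :=
  ⟨residual34_of_signatureResidual, signatureResidual_of_door hNOD⟩

/-- ONE LEVEL UP, through g33's `core_of_pieces`: CORE ⟸ NOD₃ ∧ NOS ∧ MIX ∧ NODD ∧ Residual34. -/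
theorem core_of_pieces34 (hNO3 : NearlyOrdinaryDihedralDoorThree) (hNOS : SplitOrdinaryDihedralDoor)
    (hMIX : MixedSignatureDoor) (hNOD : NearlyOrdinaryDistinguishedDoor) (hR : Residual34) : CoreResidual :=
  Summit.Langlands.Langlands.Theorems.ReductionSignatureSplit.core_of_pieces hNO3 hNOS hMIX
    (signatureResidual_of_door hNOD hR)

/-- NECESSITY: CORE ⟹ Residual34. -/
theorem residual34_of_core (h : CoreResidual) : Residual34 :=
  residual34_of_signatureResidual (signatureResidual_of_core h)

/-- EXACTNESS modulo the four junctions: CORE ⟺ Residual34. -/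
theorem core_iff_residual34 (hNO3 : NearlyOrdinaryDihedralDoorThree) (hNOS : SplitOrdinaryDihedralDoor)
    (hMIX : MixedSignatureDoor) (hNOD : NearlyOrdinaryDistinguishedDoor) : CoreResidual ↔ Residual34 :=
  ⟨residual34_of_core, core_of_pieces34 hNO3 hNOS hMIX hNOD⟩

/-- On g31's reducible corner (Borel at `3`, `5`, `7`) Residual34 asks exactly what RES33 asks: door 4c is silent there. -/
theorem residual34_pointwise_of_borel (hR : Residual34) (K₀ : Type) [Field K₀] [NumberField K₀]
    (hb : UnanchoredBox K₀) (E : WeierstrassCurve (𝓞 K₀)) (hΔ : E.Δ ≠ 0) (hr : InResidualRange K₀ E)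
    (hA : ¬ AllenLocus K₀ E) (hoff : OffDoors K₀ E) (h33 : OffSignatureDoors K₀ E) (h3 : BorelAt K₀ E 3)
    (h5 : BorelAt K₀ E 5) (h7 : BorelAt K₀ E 7) : IsModularEllipticCurve K₀ E :=
  hR K₀ hb E hΔ hr hA hoff h33 (offNODDoor_of_borel h3 h5 h7)

/-! ## §5 Compositions BY NAME up to RES, LJR, REST_E and REST = stmt-Langlands-26998 (through g33's compositions) -/

/-- RES ⟸ FLS34 ∧ SWD ∧ PZD ∧ NOD₃ ∧ NOS ∧ MIX ∧ NODD ∧ Residual34. -/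
theorem residual_of_pieces34 (h34 : FLS2015_theorems3_4) (hSW : SkinnerWilesDihedralDoor)
    (hPZ : PanZhangSupersingularDoor) (hNO3 : NearlyOrdinaryDihedralDoorThree) (hNOS : SplitOrdinaryDihedralDoor)
    (hMIX : MixedSignatureDoor) (hNOD : NearlyOrdinaryDistinguishedDoor) (hR : Residual34) :
    DyadicDegenerateResidual :=
  Summit.Langlands.Langlands.Theorems.ReductionSignatureSplit.residual_of_pieces h34 hSW hPZ hNO3 hNOS hMIX
    (signatureResidual_of_door hNOD hR)

/-- LJR ⟸ … ∧ NODD ∧ Residual34. -/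
theorem largeJResidual_of_pieces34 (hADC : AllenDyadicCorollary) (h34 : FLS2015_theorems3_4)
    (hSW : SkinnerWilesDihedralDoor) (hPZ : PanZhangSupersingularDoor) (hNO3 : NearlyOrdinaryDihedralDoorThree)
    (hNOS : SplitOrdinaryDihedralDoor) (hMIX : MixedSignatureDoor) (hNOD : NearlyOrdinaryDistinguishedDoor)
    (hR : Residual34) : LargeJResidual :=
  Summit.Langlands.Langlands.Theorems.ReductionSignatureSplit.largeJResidual_of_pieces hADC h34 hSW hPZ hNO3 hNOS hMIX
    (signatureResidual_of_door hNOD hR)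

/-- REST_E ⟸ … ∧ NODD ∧ Residual34. -/
theorem restE_of_pieces34 (hDBC : RatBaseChangeModularity) (hNSBC : SmallFieldBaseChange)
    (hFLS : FLS2015_theorem1) (hDNS : DNS2020_theorem4) (hBox : Box2022_theorem1_1)
    (hADC : AllenDyadicCorollary) (h34 : FLS2015_theorems3_4) (hSW : SkinnerWilesDihedralDoor)
    (hPZ : PanZhangSupersingularDoor) (hNO3 : NearlyOrdinaryDihedralDoorThree) (hNOS : SplitOrdinaryDihedralDoor)
    (hMIX : MixedSignatureDoor) (hNOD : NearlyOrdinaryDistinguishedDoor) (hR : Residual34) :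
    UnanchoredHighDegreeModularE :=
  Summit.Langlands.Langlands.Theorems.ReductionSignatureSplit.restE_of_pieces hDBC hNSBC hFLS hDNS hBox hADC h34 hSW
    hPZ hNO3 hNOS hMIX (signatureResidual_of_door hNOD hR)

/-- KERNEL COMPOSITION concluding REST = `TowerDoorSplit.UnanchoredHighDegreeWitnessAutomorphy`
(stmt-Langlands-26998) BY NAME, through g33's `ReductionSignatureSplit.closes_target`. -/
theorem closes_target (hDBC : RatBaseChangeModularity) (hNSBC : SmallFieldBaseChange)
    (hFLS : FLS2015_theorem1) (hDNS : DNS2020_theorem4) (hBox : Box2022_theorem1_1)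
    (hADC : AllenDyadicCorollary) (h34 : FLS2015_theorems3_4) (hSW : SkinnerWilesDihedralDoor)
    (hPZ : PanZhangSupersingularDoor) (hNO3 : NearlyOrdinaryDihedralDoorThree) (hNOS : SplitOrdinaryDihedralDoor)
    (hMIX : MixedSignatureDoor) (hNOD : NearlyOrdinaryDistinguishedDoor) (hR : Residual34)
    (hIMT : IntegralModelTransferPointwise)
    (hTr : Summit.Langlands.Langlands.Theses.EllipticDegreeLadder.EllipticTransportAnyBase)
    (hW : SatakeAvatarTwo)
    (h1 : Summit.Langlands.Langlands.Theses.EllipticDegreeLadder.RankOneAutomorphy) :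
    Summit.Langlands.Langlands.Theses.TowerDoorSplit.UnanchoredHighDegreeWitnessAutomorphy :=
  Summit.Langlands.Langlands.Theorems.ReductionSignatureSplit.closes_target hDBC hNSBC hFLS hDNS hBox hADC h34 hSW hPZ
    hNO3 hNOS hMIX (signatureResidual_of_door hNOD hR) hIMT hTr hW h1

/-- `closes_target` with W⁺ the host item `SatakeAvatarExistence` (stmt-Langlands-17415) BY NAME. -/
theorem closes_byName (hDBC : RatBaseChangeModularity) (hNSBC : SmallFieldBaseChange)
    (hFLS : FLS2015_theorem1) (hDNS : DNS2020_theorem4) (hBox : Box2022_theorem1_1)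
    (hADC : AllenDyadicCorollary) (h34 : FLS2015_theorems3_4) (hSW : SkinnerWilesDihedralDoor)
    (hPZ : PanZhangSupersingularDoor) (hNO3 : NearlyOrdinaryDihedralDoorThree) (hNOS : SplitOrdinaryDihedralDoor)
    (hMIX : MixedSignatureDoor) (hNOD : NearlyOrdinaryDistinguishedDoor) (hR : Residual34)
    (hIMT : IntegralModelTransferPointwise)
    (hTr : Summit.Langlands.Langlands.Theses.EllipticDegreeLadder.EllipticTransportAnyBase)
    (hW : Summit.Langlands.Langlands.Theses.EllipticDegreeLadder.SatakeAvatarExistence)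
    (h1 : Summit.Langlands.Langlands.Theses.EllipticDegreeLadder.RankOneAutomorphy) :
    Summit.Langlands.Langlands.Theses.TowerDoorSplit.UnanchoredHighDegreeWitnessAutomorphy :=
  closes_target hDBC hNSBC hFLS hDNS hBox hADC h34 hSW hPZ hNO3 hNOS hMIX hNOD hR hIMT hTr (satakeAvatarTwo_of_host hW) h1

/-! ### Necessity from the lineage targets (the trivial direction) -/

/-- CORE ⇒ both pieces. -/
theorem pieces_of_core (h : CoreResidual) : NODSector ∧ Residual34 :=
  signatureResidual_iff_pieces.1 (signatureResidual_of_core h)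

/-- REST_E ⇒ both pieces. -/
theorem pieces_of_restE (h : UnanchoredHighDegreeModularE) : NODSector ∧ Residual34 :=
  pieces_of_core (core_of_restE h)

end Summit.Langlands.Langlands.Theorems.NearlyOrdinaryDistinguishedSplit
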